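import Summits.BirchSwinnertonDyer.Rank1Residual.Additive.RamifiedSevenGenusLayerCharacterDirichlet
import Summits.BirchSwinnertonDyer.Rank1Residual.Additive.RamifiedSevenGenusDepletedSeriesDirichlet
import Summits.BirchSwinnertonDyer.Rank1Residual.Additive.RamifiedSevenGenusHeckeTwists
import Summits.BirchSwinnertonDyer.Rank1Residual.Additive.RamifiedSevenGenusKSideRank
import Literature.NumberTheory.EllipticCurves.DeuringGrossencharacterPinnedRigidity
import Literature.NumberTheory.EllipticCurves.ComplexMultiplicationBurungaleFlachCorOneProofs
import Literature.NumberTheory.EllipticCurves.ModularDegreeQuadraticTwistProofs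
import HarnessLib

set_option autoImplicit false

/-!
# `𝒞₇` genus road (crux `EllipticUnitValueSevenOfGZK`, K7r), row (K2C-4) block (X-a), file 3 of 3: ★ THE DEURING–SHIMURA
# TWIST DICTIONARY `Φ.HeckeTwistDictionary` DISCHARGED at every pinned frame of a CM member, ★★ (r5′) FROM FACTS, and the
# PINNED COEFFICIENT IDENTITY `a_k(V) = Σ_{N𝔞 = k, (𝔞,𝔪_ψ)=1} ψ(𝔞)` it rests on

Cell bsd-cm, seat bsd-cm-prr-ty1 g32 (literature-prover), SUMMON `wake/SUMMON-bsd-cm-prr-ty1-20260830T2007Z.md` (planner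
bsd-cm-plan g36, D945; key K2C-4), block (X-a); STATUS CHECKS (CONJ)/(ART)/(ADD) of this seat.  HONEST LABEL: THEOREMS ONLY
— no `def`, no named fact, no typed hypothesis, no instance, no notation, no `sorry`.  The ONLY input beyond the frame's
own pins (`ψ_LSeries`, `ψ_infinityType`, `bad_iff_dvd`, `finrank_Kcm`, `sqrtNegSeven_sq`, `isGalois_Kcm`,
`isTotallyComplex_Kcm`) and tree theorems is `W.HasCM` = conjunct 1 of the stub's own class binder `X12.ClassCSeven W`
(as for (rk), p783797); the conductor pin `ψ_conductor` and `γK`'s generator property are NOT used.  (r5′) is now a theorem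
modulo exactly two cite-tagged print facts (`Rohrlich1988_nonvanishing_twists_anyLevel`, the modularity witness
`IsNewformOf W f`).  stmt-BirchSwinnertonDyer-19945 is OPEN (zp v14 `6f202717661c60d4`, 5 sorries); `X12.CMRamifiedSeven`
NOT proved; no summit statement is proved by this seat; BSD is claimed for no curve.

## §E (generic) `lFunction_eq_sum_heckeCharIdealValue`
If `heckeLFunction ψ s = V.LSeries s` for `re s > s₀` (`ψ` ANY Hecke character of a number field `K`, `V` a Weierstrass curve
over a number field) then, with `𝔪` the exact ramification modulus of `ψ`, `a_k(V) = Σ_{N𝔞 = k} [𝔞 prime to 𝔪] ψ(𝔞)` for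
every `k ≠ 0` (the tree's Weil-normalised `Rigidity.intCast_lFunction_eq_weightedCoeff_of_heckeLFunction_eq_LSeries`,
`ψ₀(𝔞) = ψ(𝔞) N𝔞^{σ}`, `N𝔞^{σ} k^{−σ} = 1`); `isCoprime_iff_forall_not_le`.

## The proof of ★ (p784707's docstring «Why the dictionary is print + typing», moves (1)–(3), now run in the kernel)

For `n`, `χ` trivial on `Gal(K̄/K_{n+1})` with `χ(γK)` a primitive `7^{n+1}`-th root of unity: file 1 gives
`θ = χ_ℚ : DirichletCharacter ℂ (7^{n+2})`, PRIMITIVE, with `χ = θ ∘ χ_{7^{n+2}}` on `Γ_K` and `χ(𝔞) = θ(N𝔞)` on the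
ideals prime to `7`.  For `re s > 2` file 2 regroups `L_{(7·7d)}(ψ̄, χ, s) = Σ_k c(k) k^{−s}`,
`c(k) = Σ_{N𝔞 = k, (𝔞,(49d)) = 1} conj ψ(𝔞) θ(N𝔞)` (absolute convergence from `|ψ(ϖ_v)| = N v^{1/2}`, `Φ.ψ_infinityType`),
and it remains to see `c(k) = θ(k) a_k(W)` for `k ≠ 0` (`LSeries_congr`): if `gcd(k, 7d) = 1` every ideal of norm `k` is
prime to `(49d)` AND to the ramification modulus of `ψ` (`isUnramifiedAt_ψ`: `ψ` is unramified above the good primes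
`q ∤ 7d`, `q ∤ d_K = −7`, by the tree's `DeuringShape.isUnramifiedAt_of_pinned_of_hasGoodReduction` on `Φ.ψ_LSeries` and
`Φ.bad_iff_dvd`), so `c(k) = θ(k)·conj(Σ_{N𝔞=k} ψ(𝔞)) = θ(k)·conj(a_k) = θ(k) a_k` (`lFunction_eq_sum_heckeCharIdealValue`;
`a_k ∈ ℤ`); if a prime `q ∣ gcd(k, 7d)` then no ideal of norm `k` is prime to `(49d)` (`c(k) = 0`) and `θ(k) a_k = 0`
(`q = 7`: `k` is a non-unit mod `7^{n+2}`; `q ≠ 7`: `q ∣ d`, `W` is bad at `q` by `bad_iff_dvd` and not multiplicative by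
CM, so `a_k = 0`, tree `LFunction_apply_eq_zero_of_not_good_of_not_mult`).

## References
J. H. Silverman, *Advanced Topics* (1994) II Thm. 9.2 (b), Thm. 10.5, Ex. 2.30–2.32 [SilvermanATAEC1994]; G. Shimura (1971)
Thm. 3.66 [Shimura1971]; L. C. Washington (1997) §13.1, Ch. 3 [Washington1997]; K. Kato, Astérisque 295 (2004) Prop. 15.9
(p. 258), 13.5 (2) (p. 227), Thm. 12.5 (2) (p. 221) [Kato2004Asterisque]; D. E. Rohrlich, Invent. Math. 75 (1984) and Math. Ann.
281 (1988) [RohrlichInventiones1984]; J. H. Silverman, *AEC* (2009) VII.5 Prop. 5.1, App. C §16 [SilvermanAEC2009];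
(An) p784707, (T) p783797, (N2) p785484.
-/

noncomputable section

open scoped NumberField
open Field NumberField IsDedekindDomain
open Literature.NumberTheory.GaloisRepresentations
open Literature.NumberTheory.EllipticCurves
open Literature.NumberTheory.EllipticCurves.Kato2004
open Literature.NumberTheory.LFunctions

namespace Summit.BirchSwinnertonDyer.Rank1Residual.Additive.GenusSeven

namespace DepletedSeries

open scoped ComplexConjugate

/-! ## §E The pinned coefficient identity -/

section Pinned

variable {K : Type} [Field K] [NumberField K]

open scoped Classical in
/-- **THE PINNED COEFFICIENT IDENTITY `a_k(V) = Σ_{N𝔞 = k, (𝔞, 𝔪_ψ) = 1} ψ(𝔞)`.** If `heckeLFunction ψ s = V.LSeries s` for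
`re s > s₀` (`ψ` ANY Hecke character of `K`, `V` a Weierstrass curve over a number field) then, with `𝔪` the exact
ramification modulus of `ψ` (`ψ` unramified at `v` iff `𝔪 ≰ v`), for every `k ≠ 0`:
`a_k(V) = Σ_{N𝔞 = k} [𝔞 prime to 𝔪] ψ(𝔞)` (`ψ(𝔞) = heckeCharIdealValue`).  From the tree's Weil-normalised identity
`a_k = (Σ_{N𝔞=k} ψ₀(𝔞)) k^{−σ}` (`Rigidity.intCast_lFunction_eq_weightedCoeff_of_heckeLFunction_eq_LSeries`) and
`ψ₀(𝔞) = ψ(𝔞) N𝔞^{σ}`. [cite: NeukirchANT1999, Ch. VII §8 (8.1)] [cite: WeilBNT1967, Ch. VII §7 ¶1] [cite: SilvermanATAEC1994, II Thm. 10.5] -/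
theorem lFunction_eq_sum_heckeCharIdealValue (ψ : HeckeCharacter K) {F : Type} [Field F] [NumberField F]
    (V : WeierstrassCurve F) (s₀ : ℝ) (hpin : ∀ s : ℂ, s₀ < s.re → heckeLFunction ψ s = V.LSeries s) :
    ∃ 𝔪 : Ideal (𝓞 K), 𝔪 ≠ ⊥ ∧ (∀ v : HeightOneSpectrum (𝓞 K), ψ.IsUnramifiedAt v ↔ ¬ 𝔪 ≤ v.asIdeal) ∧
      ∀ k : ℕ, k ≠ 0 → ((V.LFunction k : ℤ) : ℂ) =
        ∑ I ∈ NumberField.idealsOfNorm K k, if IsCoprime I 𝔪 then CM.heckeCharIdealValue ψ I else 0 := by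
  classical
  obtain ⟨σ, ψ₀, 𝔪, -, h𝔪, hiff, -, hval, hcoeff⟩ :=
    DeuringCM.RamifiedSevenEllipticUnits.Rigidity.intCast_lFunction_eq_weightedCoeff_of_heckeLFunction_eq_LSeries
      ψ V s₀ hpin
  refine ⟨𝔪, h𝔪, hiff, fun k hk => ?_⟩
  rw [hcoeff k hk, NumberField.twistCount, Finset.sum_mul]
  refine Finset.sum_congr rfl fun I hI => ?_
  rw [NumberField.mem_idealsOfNorm] at hI
  have hI0 : I ≠ ⊥ := by
    intro h
    rw [h, Ideal.absNorm_bot] at hI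
    exact hk hI.symm
  have hkC : (k : ℂ) ≠ 0 := Nat.cast_ne_zero.mpr hk
  rw [rayClassCoeffHom_apply, rayClassCoeff]
  by_cases hc : IsCoprime I 𝔪
  · rw [if_pos ⟨hI0, hc⟩, if_pos hc,
      show (fun v : HeightOneSpectrum (𝓞 K) => ψ₀.valueAtUniformizer v) =
        fun v => ψ.valueAtUniformizer v * ((Ideal.absNorm v.asIdeal : ℕ) : ℂ) ^ (σ : ℂ) from funext hval,
      idealPow_mul_absNorm_cpow _ _ hI0, heckeCharIdealValue_eq_idealPow ψ hI0, hI, mul_assoc,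
      Complex.cpow_neg, mul_inv_cancel₀ (fun h0 => hkC ((Complex.cpow_eq_zero_iff _ _).mp h0).1), mul_one]
  · rw [if_neg (fun h => hc h.2), if_neg hc, zero_mul]

end Pinned

end DepletedSeries

/-! ## The dictionary at every pinned frame -/

section Frame

open Literature.NumberTheory.EllipticCurves.Rank1Residual
open Literature.NumberTheory.EllipticCurves.IwasawaAlgebra
open Literature.NumberTheory.ComplexMultiplication.EllipticUnits
open Summit.BirchSwinnertonDyer.Rank1Residual
open scoped ComplexConjugate

variable {W : WeierstrassCurve ℚ} [W.IsElliptic] [W.IsGloballyMinimal] [Fact (Nat.Prime 7)]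
  [ContinuousSMul ℤ_[7] (W.tateModule 7)] {K : ZpExtension ℚ 7} {hK : K.IsCyclotomic}
  {γ : Field.absoluteGaloisGroup ℚ} {I : IwasawaH1Data W 7 K γ}
  {F : GenusFrame} {θu : ∀ n : ℕ, globalUnitsOf (F.layer n)} {d : GenusDatum F θu}

namespace PinnedKatoGenusFrame

variable (Φ : PinnedKatoGenusFrame W K hK I d)

/-- `d_K = −7` for the frame's CM field `K = Φ.Kcm` (quadratic, contains `√−7`). [cite: SilvermanATAEC1994, App. A §3] -/
theorem discr_Kcm : NumberField.discr Φ.Kcm = -7 :=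
  Quadratic.discr_eq_of_sq_eq_intCast Φ.finrank_Kcm (θ := Φ.sqrtNegSeven) (d := -7)
    (by rw [Φ.sqrtNegSeven_sq]; push_cast; ring) (by decide)

/-- **`|ψ(ϖ_v)| = N v^{1/2}` at every place** for THE Grössencharacter of the frame (type `(1,0)`, `K` totally complex).
[cite: Kato2004Asterisque, §15.7 (p. 256)] [cite: Weil1956] -/
theorem norm_ψ_valueAtUniformizer (v : HeightOneSpectrum (𝓞 Φ.Kcm)) :
    ‖Φ.ψ.valueAtUniformizer v‖ = ((Ideal.absNorm v.asIdeal : ℕ) : ℝ) ^ (1 / 2 : ℝ) := by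
  haveI := Φ.isTotallyComplex_Kcm
  exact DepletedSeries.norm_valueAtUniformizer_of_hasInfinityType_one_zero Φ.ψ Φ.ψ_infinityType v

/-- **`ψ` is unramified off `7d`**: at a place `v ∌ 7·|D|` of `K` the pinned Grössencharacter `Φ.ψ` is unramified — the
prime `q` under `v` is `≠ 7` and `∤ d`, so `W` has good reduction at `q` (`bad_iff_dvd`), `q ∤ d_K = −7`, and a Hecke
character `L`-pinned to `W` is unramified above such `q` (`DeuringShape.isUnramifiedAt_of_pinned_of_hasGoodReduction`).
[cite: SilvermanATAEC1994, II Thm. 9.2 (b) and Thm. 10.5] -/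
theorem isUnramifiedAt_ψ (v : HeightOneSpectrum (𝓞 Φ.Kcm)) (hv : ((7 * F.d : ℕ) : 𝓞 Φ.Kcm) ∉ v.asIdeal) :
    Φ.ψ.IsUnramifiedAt v := by
  haveI := v.isMaximal
  obtain ⟨q, e, -, hqv, hq, -⟩ := Ideal.exists_prime_and_absNorm_eq_pow v.asIdeal
  haveI : Fact q.Prime := ⟨hq⟩
  have hq7 : q ≠ 7 := by
    rintro rfl
    apply hv
    rw [Nat.cast_mul]
    exact v.asIdeal.mul_mem_right _ hqv
  have hqd : ¬ q ∣ F.d := by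
    rintro ⟨c, hc⟩
    apply hv
    rw [hc, Nat.cast_mul, Nat.cast_mul]
    exact v.asIdeal.mul_mem_left _ (v.asIdeal.mul_mem_right _ hqv)
  have hgood : Good W q := by
    by_contra hbad
    exact hqd ((Φ.bad_iff_dvd q hq7).mp hbad)
  have hnd : ¬ (q : ℤ) ∣ NumberField.discr Φ.Kcm := by
    rw [Φ.discr_Kcm, dvd_neg, show (7 : ℤ) = ((7 : ℕ) : ℤ) by norm_num, Int.natCast_dvd_natCast,
      Nat.dvd_prime (by norm_num : Nat.Prime 7)]
    rintro (h | h)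
    · exact hq.one_lt.ne' h
    · exact hq7 h
  exact DeuringCM.RamifiedSevenEllipticUnits.DeuringShape.isUnramifiedAt_of_pinned_of_hasGoodReduction
    Φ.finrank_Kcm Φ.ψ_LSeries hgood hnd v hqv

/-- **★ THE TWIST DICTIONARY, DISCHARGED** (row K2C-4 (X-a); the three moves of `RamifiedSevenGenusHeckeTwists`' docstring
«Why the dictionary is print + typing», now PROVED): for a member with complex multiplication (the only input beyond the
frame's own pins — `Φ.ψ_LSeries`, `Φ.ψ_infinityType`, `Φ.bad_iff_dvd`, `Φ.finrank_Kcm`, `Φ.sqrtNegSeven_sq` — and the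
tree) the typed hypothesis `Φ.HeckeTwistDictionary` HOLDS.  (1) COEFFICIENTS `a_k(W) = Σ_{N𝔞 = k} ψ(𝔞)` for `k` prime to
`7d` (`lFunction_eq_sum_heckeCharIdealValue` + `isUnramifiedAt_ψ`); (2) CHARACTERS `χ = χ_ℚ ∘ χ_{7^{n+2}}` on `Γ_K`,
`χ_ℚ` primitive (`LayerCharacter.exists_dirichletCharacter`, `isPrimitive_of_isPrimitiveRoot`), so `χ(𝔞) = χ_ℚ(N𝔞)` off
`7` (`heckeIdealValue_eq`); (3) DEPLETION INVISIBLE: `χ_ℚ(k) = 0` for `7 ∣ k`, `a_k(W) = 0` for `q ∣ k`, `q ∣ d` (additive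
reduction: CM and `bad_iff_dvd`).  Real coefficients: `a_k ∈ ℤ`, so `ψ ↦ ψ̄` is harmless.
[cite: SilvermanATAEC1994, II Thm. 10.5] [cite: Shimura1971, Thm. 3.66] [cite: Washington1997, §13.1 and Ch. 3] [cite: Kato2004Asterisque, Prop. 15.9 (p. 258)] -/
theorem heckeTwistDictionary_of_hasCM (hCM : W.HasCM) : Φ.HeckeTwistDictionary := by
  classical
  intro n χ hχ hprim
  haveI := Φ.isGalois_Kcm
  obtain ⟨θ, -, hθ⟩ := LayerCharacter.exists_dirichletCharacter K hK (by decide) Φ.finrank_Kcm n (N := 7 ^ (n + 2))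
    rfl χ hχ
  refine ⟨θ, LayerCharacter.isPrimitive_of_isPrimitiveRoot n rfl χ θ hθ hprim, fun s hs => ?_⟩
  -- notation
  set m : ℕ := 7 * (7 * F.d) with hm
  have h7m : (7 : ℕ) ∣ m := Dvd.intro _ rfl
  -- `χ(𝔞) = θ(N𝔞)` on the ideals prime to `(m)`
  have hχI : ∀ J : Ideal (𝓞 Φ.Kcm), J ≠ ⊥ → IsCoprime J (Ideal.span {(m : 𝓞 Φ.Kcm)}) →
      heckeIdealValue χ J = θ (Ideal.absNorm J) := by
    intro J hJ hcop
    refine LayerCharacter.heckeIdealValue_eq (p := 7) (n + 2) rfl χ θ hθ hJ fun v hv h7 => ?_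
    rw [DepletedSeries.isCoprime_span_natCast_iff] at hcop
    obtain ⟨c, hc⟩ := h7m
    exact hcop v (Ideal.le_of_dvd hv) (by rw [hc, Nat.cast_mul]; exact v.asIdeal.mul_mem_right _ h7)
  -- LHS regrouped by the norm
  rw [DepletedSeries.depletedHeckeLSeries_eq_LSeries Φ.ψ χ m (fun v => (Φ.norm_ψ_valueAtUniformizer v).le)
    (fun J hcop => ?_) (by linarith)]
  swap
  · by_cases hJ : J = ⊥
    · subst hJ; simp [heckeIdealValue]
    · rw [hχI J hJ hcop]; exact DirichletCharacter.norm_le_one θ _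
  -- the pinned coefficient identity
  obtain ⟨𝔪, h𝔪, hiff, hcoeff⟩ :=
    DepletedSeries.lFunction_eq_sum_heckeCharIdealValue Φ.ψ W (3 / 2) Φ.ψ_LSeries
  refine LSeries_congr (fun {k} hk => ?_) s
  by_cases hcop : k.Coprime (7 * F.d)
  · -- (1)+(2): every ideal of norm `k` is prime to `(m)` and to `𝔪_ψ`, and `χ(𝔞) = θ(k)` on them
    have hcopm : k.Coprime m := Nat.Coprime.mul_right (Nat.Coprime.coprime_mul_right_right hcop) hcop
    have hterm : ∀ J ∈ NumberField.idealsOfNorm Φ.Kcm k,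
        (if IsCoprime J (Ideal.span {(m : 𝓞 Φ.Kcm)}) then conj (CM.heckeCharIdealValue Φ.ψ J) * heckeIdealValue χ J
          else 0) = θ k * conj (if IsCoprime J 𝔪 then CM.heckeCharIdealValue Φ.ψ J else 0) := by
      intro J hJ
      rw [NumberField.mem_idealsOfNorm] at hJ
      have hJ0 : J ≠ ⊥ := by
        intro h; rw [h, Ideal.absNorm_bot] at hJ; exact hk hJ.symm
      have hc1 : IsCoprime J (Ideal.span {(m : 𝓞 Φ.Kcm)}) :=
        (DepletedSeries.isCoprime_span_natCast_iff_coprime_absNorm hJ0 m).mpr (hJ ▸ hcopm)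
      have hc2 : IsCoprime J 𝔪 := by
        rw [DepletedSeries.isCoprime_iff_forall_not_le]
        intro v hJv
        rw [← hiff]
        refine Φ.isUnramifiedAt_ψ v ?_
        have hN := (DepletedSeries.coprime_absNorm_iff hJ0 (7 * F.d)).mp (hJ ▸ hcop) v (Ideal.dvd_iff_le.mpr hJv)
        exact hN
      rw [if_pos hc1, if_pos hc2, hχI J hJ0 hc1, hJ, mul_comm]
    rw [Finset.sum_congr rfl hterm, ← Finset.mul_sum, ← map_sum, ← hcoeff k hk, map_intCast]
  · -- (3): a prime `q ∣ gcd(k, 7d)`; no ideal of norm `k` is prime to `(m)`; and `θ(k) a_k = 0`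
    obtain ⟨q, hq, hqk, hq7d⟩ := Nat.Prime.not_coprime_iff_dvd.mp hcop
    haveI : Fact q.Prime := ⟨hq⟩
    have hlhs : ∀ J ∈ NumberField.idealsOfNorm Φ.Kcm k,
        (if IsCoprime J (Ideal.span {(m : 𝓞 Φ.Kcm)}) then conj (CM.heckeCharIdealValue Φ.ψ J) * heckeIdealValue χ J
          else 0) = 0 := by
      intro J hJ
      rw [NumberField.mem_idealsOfNorm] at hJ
      have hJ0 : J ≠ ⊥ := by
        intro h; rw [h, Ideal.absNorm_bot] at hJ; exact hk hJ.symm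
      rw [if_neg]
      rw [DepletedSeries.isCoprime_span_natCast_iff_coprime_absNorm hJ0 m, hJ]
      intro h
      exact Nat.Prime.not_coprime_iff_dvd.mpr ⟨q, hq, hqk, hq7d.trans (Dvd.intro_left 7 rfl)⟩ h
    rw [Finset.sum_congr rfl hlhs, Finset.sum_const_zero]
    by_cases hq7 : q = 7
    · -- `θ(k) = 0`
      subst hq7
      have hku : ¬ IsUnit ((k : ℕ) : ZMod (7 ^ (n + 2))) := by
        rw [ZMod.isUnit_iff_coprime]
        intro h
        exact Nat.Prime.not_coprime_iff_dvd.mpr ⟨7, hq, hqk, dvd_pow_self 7 (by omega)⟩ h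
      rw [θ.map_nonunit hku, zero_mul]
    · -- `a_k(W) = 0`: `q ∣ d`, so `W` is bad at `q` (frame) and not multiplicative (CM): additive
      have hqd : q ∣ F.d := by
        rcases (Nat.Prime.dvd_mul hq).mp hq7d with h | h
        · exact absurd ((Nat.prime_dvd_prime_iff_eq hq (by norm_num)).mp h) hq7
        · exact h
      have hng : ¬ Good W q := (Φ.bad_iff_dvd q hq7).mpr hqd
      rw [WeierstrassCurve.LFunction_apply_eq_zero_of_not_good_of_not_mult W q hng
        (W.not_hasMultiplicativeReductionAtPrime_of_hasCM hCM q) hqk, Int.cast_zero, mul_zero]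

/-- **★ on `𝒞₇`**: the dictionary holds for every member of the class (`X12.ClassCSeven W`, conjunct 1 = `W.HasCM`).
[cite: SilvermanATAEC1994, II Thm. 10.5] [cite: Kato2004Asterisque, Prop. 15.9 (p. 258)] -/
theorem heckeTwistDictionary_of_classCSeven (hC : X12.ClassCSeven W) : Φ.HeckeTwistDictionary :=
  Φ.heckeTwistDictionary_of_hasCM hC.1

/-- **★★ (r5′) FROM FACTS** — the binder (r5′) of `stub_integralComparisonInputsSeven` (zp v14 l.559–563, VERBATIM) at every
pinned frame of a `𝒞₇` member, modulo exactly TWO cite-tagged print facts: Rohrlich 1988 (`Rohrlich1988_nonvanishing_twists_anyLevel`)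
and the modularity witness `IsNewformOf W f`; the typed dictionary of p784707 is DISCHARGED (`heckeTwistDictionary_of_classCSeven`).
CONDITIONAL on those; stmt-BirchSwinnertonDyer-19945 is OPEN; no summit statement is proved here.
[cite: Kato2004Asterisque, 13.5 (2) (p. 227) and Thm. 12.5 (2) (p. 221)] [cite: RohrlichInventiones1984, Theorem (p. 409)] -/
theorem r5'_of_facts (hRo : Rohrlich1988_nonvanishing_twists_anyLevel) (hC : X12.ClassCSeven W) {N : ℕ} [NeZero N]
    {f : CuspForm (CongruenceSubgroup.Gamma0 N) 2} (hf : ModularForms.IsNewformOf W f) :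
    ∃ n₁ : ℕ, ∀ n : ℕ, n₁ ≤ n → ∀ χ : Field.absoluteGaloisGroup Φ.Kcm →ₜ* ℂˣ,
      (∀ σ ∈ (K.restrictOfFinrankEqTwo (by decide) Φ.Kcm Φ.finrank_Kcm).layerSubgroup (n + 1), χ σ = 1) →
      IsPrimitiveRoot (((χ Φ.γK : ℂˣ)) : ℂ) (7 ^ (n + 1)) →
      ∀ Lf : ℂ → ℂ, CM.IsDepletedHeckeL Φ.ψ χ (7 * (7 * F.d)) Lf → Lf 1 ≠ 0 :=
  Φ.r5'_of_inputs hRo hf (Φ.heckeTwistDictionary_of_classCSeven hC)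

end PinnedKatoGenusFrame

end Frame

end Summit.BirchSwinnertonDyer.Rank1Residual.Additive.GenusSeven

end
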